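import Summits.CriticalPhenomena.PercolationContinuityZ3.Theorems.Transplant.Z3NetSkeleton
import Summits.CriticalPhenomena.PercolationContinuityZ3.Theorems.Transplant.BenjaminiSchrammResidue
import Literature.Probability.Percolation.ThetaContinuityGraphCriterion
import Literature.Barriers.CriticalPhenomena.SubexponentialGrowthZdBurtonKeane
import HarnessLib

/-!
# Every net on `ℤ³` with sign data (`Z3Net.SignData`) has CUBIC GROWTH, is amenable, has a unique infinite cluster at every density, and its
# percolation probability `p ↦ θ_N(v, p)` is a CONTINUOUS FUNCTION on `[0, 1]` at every vertex

builds on p205010 (kernel theorem, internal audit signed; external expert review pending) — only `continuous_theta` uses p205010 (through the D″ node's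
`Z3Net.SignData.criticalContinuity`).  Lane `prim-bschramm`, class C1b, seat `prim-bschramm-p2` gen 15; helper file (`--supports stmt-CriticalPhenomena-4575`).
Memo `HOME/bschramm/P2-LATTICES.md` §40.  No definitions.
The C1b device of gen 12 (`Z3NetSkeleton`: `θ_N(v, p_c(N, v)) = 0` for every periodic bond structure `N` on `ℤ³` with `SignData`, e.g. all rung-diluted cubic
lattices) recorded connectedness, quasi-transitivity and `p_c < 1` (`conj4_hypotheses`) but not the GROWTH of the net; this file supplies it: along an edge
the planar coordinates move by `≤ 1` (`SignData.lip`) and the vertical one by `≤ R` (`SignData.vertical_adj`), so `B(x, n)` sits in a cube of side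
`2n·max(1,R) + 1` (`ballVolume_le`), the growth is cubic (`polynomialGrowth`, `not_hasExponentialGrowth`) — every such net lies OUTSIDE Hutchcroft's
exponential-growth theorem and inside Burton–Keane's: `isGraphAmenable`, **`numInfiniteClusters_le_one`** (a.s. uniqueness at every `p`).  With the generic
van den Berg–Keane criterion (`VdBK.continuous_theta_iff_of_unique`, Literature) the class-C1b ∀-family gets the continuity column:
**`continuous_theta` — `p ↦ θ_N(v, p)` is continuous on `[0, 1]` at every vertex of every net with sign data.**
[cite: LyonsPeres2016, §6.1 (growth) and Thm. 7.6] [cite: BurtonKeane1989, Thm. 2] [cite: VandenBergKeane1984, Theorem] [cite: BenjaminiSchramm1996, Conj. 4]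
-/

noncomputable section

namespace Summit.CriticalPhenomena.PercolationContinuityZ3.Theorems.Transplant

namespace Z3Net

namespace SignData

open MeasureTheory Filter Literature.Probability.Percolation Literature.Probability.LatticeModels SimpleGraph
open Literature.Barriers.CriticalPhenomena (IsQuasiTransitive IsGraphAmenable HasExponentialGrowth graphBall ballVolume
  hasExponentialGrowth_of_not_isGraphAmenable BurtonKeane1989_atMostOneInfiniteCluster_holds)
open Literature.Probability.Percolation.VdBK
open Z3Diag (proj)
open scoped Classical

variable {N : Z3Net}

/-! ## §1 Cubic growth -/

/-- Along an edge every coordinate moves by at most `max(1, R)`. [folklore] -/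
theorem abs_sub_le_of_adj (D : N.SignData) {x y : Site 3} (h : N.graph.Adj x y) (i : Fin 3) : |y i - x i| ≤ max 1 (D.R : ℤ) := by
  fin_cases i
  · have h0 := D.lip h 0
    rw [abs_sub_comm] at h0
    exact le_trans (by simpa [proj] using h0) (le_max_left _ _)
  · have h1 := D.lip h 1
    rw [abs_sub_comm] at h1
    exact le_trans (by simpa [proj] using h1) (le_max_left _ _)
  · exact (D.vertical_adj h).trans (le_max_right _ _)

/-- Along a walk of length `n` every coordinate moves by at most `n · max(1, R)`. [folklore] -/
theorem abs_sub_le_length (D : N.SignData) {x y : Site 3} (w : N.graph.Walk x y) (i : Fin 3) : |y i - x i| ≤ (w.length : ℤ) * max 1 (D.R : ℤ) := by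
  induction w with
  | nil => simp
  | @cons a b c hab w ih =>
    have h1 := D.abs_sub_le_of_adj hab i
    have h2 : |c i - a i| ≤ |c i - b i| + |b i - a i| := by
      have := abs_sub_le (c i) (b i) (a i); linarith
    simp only [SimpleGraph.Walk.length_cons, Nat.cast_add, Nat.cast_one]
    linarith

/-- **Cubic growth**: `|B(x, n)| ≤ (2 n max(1,R) + 1)³` (the ball, translated by `−x`, sits in the cube `[−nR', nR']³`, `R' = max(1, R)`).
[cite: LyonsPeres2016, §6.1 (growth of balls)] -/
theorem ballVolume_le (D : N.SignData) (x : Site 3) (n : ℕ) : ballVolume N.graph x n ≤ (2 * (n * max 1 D.R) + 1) ^ 3 := by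
  set M : ℕ := n * max 1 D.R with hM
  set f : Site 3 → Site 3 := fun y => y - x with hf
  have hinj : Function.Injective f := fun y z h => sub_left_injective h
  set B : Finset (Site 3) := Fintype.piFinset fun _ : Fin 3 => Finset.Icc (-(M : ℤ)) M with hB
  have hBcard : B.card = (2 * M + 1) ^ 3 := by
    rw [hB, Fintype.card_piFinset, Finset.prod_const, Finset.card_univ, Fintype.card_fin, Int.card_Icc]
    have h1 : ((M : ℤ) + 1 - -(M : ℤ)).toNat = 2 * M + 1 := by omega
    rw [h1]
  have hsub : f '' graphBall N.graph x n ⊆ (↑B : Set (Site 3)) := by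
    rintro _ ⟨y, ⟨w, hw⟩, rfl⟩
    rw [Finset.mem_coe, hB, Fintype.mem_piFinset]
    intro i
    have hn : (w.length : ℤ) ≤ n := by exact_mod_cast hw
    have h := D.abs_sub_le_length w i
    have hR : (w.length : ℤ) * max 1 (D.R : ℤ) ≤ (M : ℤ) := by
      rw [hM]; push_cast
      exact mul_le_mul_of_nonneg_right hn (by positivity)
    have hab := abs_le.1 (h.trans hR)
    rw [Finset.mem_Icc]
    exact ⟨hab.1, hab.2⟩
  unfold ballVolume
  rw [← Set.ncard_image_of_injective _ hinj, ← hBcard, ← Set.ncard_coe_finset]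
  exact Set.ncard_le_ncard hsub B.finite_toSet

/-- **Uniform polynomial (cubic) growth**: `|B(x, n)| ≤ (2R'+1)³ (n+1)³`, `R' = max(1, R)`. [cite: LyonsPeres2016, §6.1] -/
theorem polynomialGrowth (D : N.SignData) : ∃ C E : ℝ, ∀ (x : Site 3) (n : ℕ), (ballVolume N.graph x n : ℝ) ≤ C * ((n : ℝ) + 1) ^ E := by
  refine ⟨((2 : ℝ) * max 1 D.R + 1) ^ 3, ((3 : ℕ) : ℝ), fun x n => ?_⟩
  rw [Real.rpow_natCast]
  have h1 : (ballVolume N.graph x n : ℝ) ≤ (2 * (n * (max 1 D.R : ℕ)) + 1 : ℝ) ^ 3 := by exact_mod_cast D.ballVolume_le x n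
  have hR : (1 : ℝ) ≤ (max 1 D.R : ℕ) := by exact_mod_cast le_max_left 1 D.R
  have hn : (0 : ℝ) ≤ n := Nat.cast_nonneg n
  have h2 : (2 * (n * (max 1 D.R : ℕ)) + 1 : ℝ) ≤ (2 * (max 1 D.R : ℕ) + 1) * ((n : ℝ) + 1) := by nlinarith
  have h3 : (2 * (n * (max 1 D.R : ℕ)) + 1 : ℝ) ^ 3 ≤ ((2 * (max 1 D.R : ℕ) + 1) * ((n : ℝ) + 1)) ^ 3 :=
    pow_le_pow_left₀ (by positivity) h2 3
  rw [mul_pow] at h3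
  exact h1.trans h3

/-- **No net with sign data has exponential growth** (the family lies outside Hutchcroft's theorem). [cite: Hutchcroft2016, Thm. 1] -/
theorem not_hasExponentialGrowth (D : N.SignData) : ¬ HasExponentialGrowth N.graph :=
  not_hasExponentialGrowth_of_polynomialGrowth N.graph 0 D.polynomialGrowth

/-! ## §2 Amenability, uniqueness, continuity of `θ` -/

/-- **Every net with sign data is amenable** (quasi-transitive of subexponential growth). [cite: LyonsPeres2016, §6.1 (p. 279)] -/
theorem isGraphAmenable (D : N.SignData) : IsGraphAmenable N.graph := by
  by_contra h
  exact D.not_hasExponentialGrowth (hasExponentialGrowth_of_not_isGraphAmenable _ D.graph_quasiTransitive h)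

/-- **Uniqueness of the infinite cluster at every density on every net with sign data** (Burton–Keane for connected quasi-transitive amenable graphs).
[cite: BurtonKeane1989, Thm. 2] [cite: LyonsPeres2016, Thm. 7.6] -/
theorem numInfiniteClusters_le_one (D : N.SignData) (p : unitInterval) : ∀ᵐ ω ∂(bondPercolation N.graph p), numInfiniteClusters ω ≤ 1 :=
  BurtonKeane1989_atMostOneInfiniteCluster_holds _ D.graph_connected D.graph_quasiTransitive D.isGraphAmenable p

/-- **Scope record with amenability**: connected, quasi-transitive, amenable, `p_c < 1` everywhere — every hypothesis of Benjamini–Schramm's Conjecture 4 and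
of Burton–Keane. [cite: BenjaminiSchramm1996, Conj. 4 and §4] -/
theorem conj4_hypotheses_amenable (D : N.SignData) :
    N.graph.Connected ∧ IsQuasiTransitive N.graph ∧ IsGraphAmenable N.graph ∧ ∀ v, criticalProb N.graph v < 1 :=
  ⟨D.graph_connected, D.graph_quasiTransitive, D.isGraphAmenable, D.criticalProb_lt_one⟩

/-- **`p ↦ θ_N(v, p)` is CONTINUOUS on `[0, 1]` at every vertex of every net on `ℤ³` with sign data** (van den Berg–Keane: `θ_N(v, p_c) = 0` by the D″
node, uniqueness above `p_c` by Burton–Keane) — builds on p205010 (kernel theorem, internal audit signed; external expert review pending).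
[cite: VandenBergKeane1984, Theorem] [cite: BenjaminiSchramm1996, Conj. 4] -/
theorem continuous_theta (D : N.SignData) (v : Site 3) : Continuous fun p : unitInterval => theta N.graph v p :=
  (continuous_theta_iff_of_unique N.graph v fun p _ => D.numInfiniteClusters_le_one p).2 (D.criticalContinuity v)

end SignData

end Z3Net

end Summit.CriticalPhenomena.PercolationContinuityZ3.Theorems.Transplant

end
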